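import Summits.QuantumFields.YangMills.Theorems.FluctuationComparisonRegPrIntLS2BetaCurlBudgetPhysical
import Summits.QuantumFields.YangMills.Theorems.FluctuationComparisonRegPrIntLS2BetaCurvatureRecursionLeast
import Summits.QuantumFields.YangMills.Theorems.FluctuationComparisonRegPrIntLS2BetaWindowsOfProfiles
import HarnessLib

/-!
# S2β · (SCT″-c)₁ — «THE c₁ LETTER OVER (BKG) + (REG)@rep + C-M LETTERS ONLY»: ✓p841065 `c1Budget_physical`'s line-recursion quadruple `(ε) (hε0 hεnn hε) (hεp)`
# DISCHARGED by px12 g27's ✓p841184 `epsLetters_of_profile` — `ε := Σ_{i<k} L^{k−1−i}·2α_i`, the least solution, with the EXPLICIT profile constant `Cε := 2Cα∕(L²−L)`,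
# `Cα = ((d+2)L)²∕4·(C_B+1)α` — and its per-level chart-window family `(hwin)` DISCHARGED by ✓p841192 `windows_of_profiles` from ONE K-free window
# `hwinK : 100·ℓ·(2·Dm·Cδ + (2Cε + Cδ)) ≤ ρr` (`ℓ = (d+2)L`, `Dm = (d−1)·2L`, `Cδ = 2(C_B+1)α`; `+ Nat.cast_pow` for the knot's `((L^(k−i) : ℕ) : ℝ)`, `+ L^{2k}q ≤ 1`).
# After this file the c₁ letter `c1Budget_regRep` displays ONLY: (T) `Mg`∕`Mbar` windows (✓p836413 station prefix) · the (BKG) binder + its smallnesses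
# (`h24 hSU hρα hρδ hwinK`) · the size side `hMb hMbsq hMbm` (px20's C-M ✓p840608 output currency; px12's ⧗(C-M↓) inhabits it at the chart tower) · the (REG)@rep
# letters `r` (+ `hr`, profile `Cr`∕`hrp`), `c₀` (+ `hc₀`, profile `Cc`∕`hcc`), the transported size `mT` (+ `hMT`) · `hζc` (w5's ⧗(γ) inhabits it at the smooth-moved
# triple) · radii `ρr a₀` · texts `REL`, `S′`.

Cell `ym3-torus` (YM ladder rung R3 = continuum `SU(2)` Yang–Mills on the three-torus at fixed lattice data — a RUNG: NOT d = 4, NOT infinite volume, NOT a mass gap,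
NOT Clay).  Width seat `ym-ust-20520-w4` (gen 29); crux `stmt-QuantumFields-20520`, LINE g18-1 S2β; piece (g3) (INTENT 2026-09-01T05:01:03Z; px12 g27 05:00:16Z «yours»,
px17 g23 GO 05:01:11Z, px20 g25 05:01:56Z «do not fold C-M inside (g3)»).  `--kind proof --supports stmt-QuantumFields-20520 --as helper`, count-neutral,
DEFINITION-FREE (0 `def`, 0 `instance`, 0 `notation`, 0 `sorry`, default heartbeats).

WHAT IS PROVED (sorry-free; composition BY NAME + elementary arithmetic).  ★★`epsWin_of_bkg (C_B α) (hCB) (hα) (hwinK)` : the 5-tuple ⟨`ε 0 = 0`, `0 ≤ ε i`,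
`L·ε i + 2α i ≤ ε (i+1)` (`i < K−J`), `ε i ≤ Cε·L^{2i}·q` (`i < K−J`), the knot's `hwin` family⟩ for the least solution `ε` (stated β-reduced, inner `α`-redexes kept —
the shape ✓p841065's binders take after instantiation); ★★★`c1Budget_regRep` = ✓p841065 with `(ε hε0 hεnn hε hwin … Cε hCε hεp)` REPLACED by `hwinK` and `Cε`
substituted into PROFILED's level-free `o` — `obtain ⟨…⟩ := epsWin_of_bkg …; exact c1Budget_physical …`.

DOMAIN LINE (plan (3) v4; architect px17 g23 05:01:11Z «the station's last discharge by name … after (g3) the c₁ column's displayed list should read ONLY: BKG class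
(C_B, α + the four windows), Thm 2 letters …»).  [Balaban1985Averaging] (19)–(20) p.21, Prop. 3 (121)–(125) p.36, Prop. 4 (128)–(135) pp.37–38;
[Balaban1985RegularSpaces] Thm 2 (1.36) p.82; [Balaban1987RG1] (0.11), (0.18) pp.253–255.

HONEST SCOPE.  Composition of landed letters plus elementary arithmetic; nothing of Bałaban's renormalisation-group analysis is asserted or proved; every displayed
letter∕profile is a HYPOTHESIS or others'; GAP♯∘ (`stub_uniformFibreGapOrbit`, registry 3732b7df UNTOUCHED, 0∕5), S2β, the five registered stubs, crux 20520, 19936,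
19200 and `YM3TorusSU2` are NOT proved; no registered stub is closed; rung R3 — NOT d = 4, NOT infinite volume, NOT a mass gap, NOT Clay; the Yang–Mills mass gap is
NOT proved.
-/

set_option autoImplicit false

noncomputable section

open scoped Matrix.Norms.L2Operator
open Finset

namespace Summit.QuantumFields.YangMills.Theorems.FluctuationComparisonRegPrIntLS2BetaCurlBudgetRegRep

open Literature.MathematicalPhysics.QuantumFieldTheory.Balaban1983to89
open Literature.MathematicalPhysics.QuantumFieldTheory.Balaban1983to89.T4Continuum
open Literature.MathematicalPhysics.QuantumFieldTheory.Balaban1983to89.T3ContinuumYM3Torus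
open Literature.MathematicalPhysics.QuantumFieldTheory.Balaban1983to89.T3LevelShift
open Literature.MathematicalPhysics.QuantumFieldTheory.Balaban1983to89.T3TiltDescent
open Literature.MathematicalPhysics.QuantumFieldTheory.Balaban1983to89.T3UnitLawDensityEML (ℰp)
open Literature.MathematicalPhysics.QuantumFieldTheory.Balaban1983to89.T4HaarSU2ExpChart (expPoint)
open Literature.MathematicalPhysics.QuantumFieldTheory.Balaban1983to89.T4ExpWindowSmallField (logVec)
open Literature.MathematicalPhysics.QuantumFieldTheory.Balaban1983to89.HaarExponentialChart
open Literature.MathematicalPhysics.QuantumFieldTheory.Balaban1983to89.HaarExponentialChart.IsChartRep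
open Literature.MathematicalPhysics.QuantumFieldTheory.Balaban1983to89.BlockAveraging (Idx blockAvg avgFun loopHol)
open Literature.MathematicalPhysics.QuantumFieldTheory.Balaban1983to89.ExpMeanLog (expMeanLogSU deltaSU)
open Literature.MathematicalPhysics.QuantumFieldTheory.Balaban1983to89.BlockAveragingEMLLinearisedBackground (covWalkSum)
open Literature.MathematicalPhysics.QuantumFieldTheory.Balaban1983to89.B10Eq47AxialChi (shiftN)
open Literature.MathematicalPhysics.QuantumFieldTheory.Balaban1983to89.B14.Eq22Determines (blockIter)
open Literature.MathematicalPhysics.QuantumFieldTheory.Balaban1983to89.B10Eq27TorusAxialLog (rel)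
open Literature.MathematicalPhysics.QuantumFieldTheory.Balaban1983to89.B10Eq18SigmaSU2 (su2Coord)
open Literature.MathematicalPhysics.QuantumFieldTheory.Balaban1983to89.B10Eq18SigmaSU2Haar (rev)
open Literature.MathematicalPhysics.QuantumLattice (su2Quat)
open Summit.QuantumFields.YangMills.Theorems.FluctuationComparisonRegPrIntLS2BetaChartReadDescentOntoExpPoint (su2Coord_rev_mem_lie)
open Summit.QuantumFields.YangMills.Theorems.FluctuationComparisonRegPrIntLS2BetaCurlBudgetPhysical (c1Budget_physical)
open Summit.QuantumFields.YangMills.Theorems.FluctuationComparisonRegPrIntLS2BetaCurvatureRecursionLeast (epsLetters_of_profile)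
open Summit.QuantumFields.YangMills.Theorems.FluctuationComparisonRegPrIntLS2BetaWindowsOfProfiles (windows_of_profiles)
open Literature.MathematicalPhysics.QuantumFieldTheory.Balaban1983to89.B10Eq47AxialChi (rowProd)
open Summit.QuantumFields.YangMills.Theorems.FluctuationComparisonRegPrIntLS2BetaChartReadGaugeCovariance (conj_mem_lie)
open Summit.QuantumFields.YangMills.Theorems.FluctuationComparisonRegPrIntLS2BetaSourceClassesOfBkg (plaqSmall_iter_of_bkg dist1_loopHol_iter_le_of_bkg bkgClass_nonneg bkgClass_lt_two_mul bkgClass_le_base)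
open Literature.MathematicalPhysics.QuantumFieldTheory.Balaban1983to89.ExpMeanLog (deltaSU_pos)

variable (F : T3Family)

/-- ★★ **THE LINE RECURSION AND ITS WINDOWS FROM (BKG)** — ✓p841184 `epsLetters_of_profile` + ✓p841192 `windows_of_profiles` at the station: the least
solution `ε` of `L·ε_i + 2α_i ≤ ε_(i+1)`, `ε_0 = 0` for the (BKG) loop class `α`, its one-power profile with `Cε := 2Cα∕(L²−L)`, and the knot's per-level
chart windows from ONE K-free window. [cite: Balaban1985Averaging, (19)-(20) p.21, Prop. 4 (128)-(135) pp.37-38] -/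
theorem epsWin_of_bkg {J K : ℕ} (C_B α : ℝ) (hCB : 0 ≤ C_B) (hα : 0 < α) {ρr : ℝ}
    (hwinK : 100 * (((((F.P K).d + 2) * (F.P K).L : ℕ) : ℝ) * (2 * ((((F.P K).d - 1 : ℕ) : ℝ) * ((2 * (F.P K).L : ℕ) : ℝ)) * (2 * ((C_B + 1) * α)) + (2 * (2 * ((((((F.P K).d + 2) * (F.P K).L : ℕ) : ℝ) ^ 2 / 4) * ((C_B + 1) * α)) / (((F.P K).L : ℝ) ^ 2 - ((F.P K).L : ℝ))) + (2 * ((C_B + 1) * α))))) ≤ ρr) :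
    (∑ i' ∈ Finset.range 0, ((F.P K).L : ℝ) ^ (0 - 1 - i') * (2 * (fun l : ℕ => if l < K - J then (((((F.P K).d + 2) * (F.P K).L : ℕ) : ℝ) ^ 2 / 4) * ((C_B + 1) * α * (F.L : ℝ) ^ (2 * l) * ((F.L : ℝ)⁻¹) ^ (2 * (K - J))) else 0) i') = 0) ∧
    (∀ i : ℕ, 0 ≤ ∑ i' ∈ Finset.range i, ((F.P K).L : ℝ) ^ (i - 1 - i') * (2 * (fun l : ℕ => if l < K - J then (((((F.P K).d + 2) * (F.P K).L : ℕ) : ℝ) ^ 2 / 4) * ((C_B + 1) * α * (F.L : ℝ) ^ (2 * l) * ((F.L : ℝ)⁻¹) ^ (2 * (K - J))) else 0) i')) ∧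
    (∀ i, i < K - J → ((F.P K).L : ℝ) * (∑ i' ∈ Finset.range i, ((F.P K).L : ℝ) ^ (i - 1 - i') * (2 * (fun l : ℕ => if l < K - J then (((((F.P K).d + 2) * (F.P K).L : ℕ) : ℝ) ^ 2 / 4) * ((C_B + 1) * α * (F.L : ℝ) ^ (2 * l) * ((F.L : ℝ)⁻¹) ^ (2 * (K - J))) else 0) i')) + 2 * (fun l : ℕ => if l < K - J then (((((F.P K).d + 2) * (F.P K).L : ℕ) : ℝ) ^ 2 / 4) * ((C_B + 1) * α * (F.L : ℝ) ^ (2 * l) * ((F.L : ℝ)⁻¹) ^ (2 * (K - J))) else 0) i ≤ ∑ i' ∈ Finset.range (i + 1), ((F.P K).L : ℝ) ^ ((i + 1) - 1 - i') * (2 * (fun l : ℕ => if l < K - J then (((((F.P K).d + 2) * (F.P K).L : ℕ) : ℝ) ^ 2 / 4) * ((C_B + 1) * α * (F.L : ℝ) ^ (2 * l) * ((F.L : ℝ)⁻¹) ^ (2 * (K - J))) else 0) i')) ∧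
    (∀ i, i < K - J → ∑ i' ∈ Finset.range i, ((F.P K).L : ℝ) ^ (i - 1 - i') * (2 * (fun l : ℕ => if l < K - J then (((((F.P K).d + 2) * (F.P K).L : ℕ) : ℝ) ^ 2 / 4) * ((C_B + 1) * α * (F.L : ℝ) ^ (2 * l) * ((F.L : ℝ)⁻¹) ^ (2 * (K - J))) else 0) i') ≤ (2 * ((((((F.P K).d + 2) * (F.P K).L : ℕ) : ℝ) ^ 2 / 4) * ((C_B + 1) * α)) / (((F.P K).L : ℝ) ^ 2 - ((F.P K).L : ℝ))) * ((F.P K).L : ℝ) ^ (2 * i) * ((F.L : ℝ) ^ (2 * (K - J)))⁻¹) ∧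
    (∀ k, k < K - J → ∀ i, i < k → 100 * (((((F.P K).d + 2) * (F.P K).L : ℕ) : ℝ) * (((((F.P K).d - 1 : ℕ) : ℝ) * ((2 * (F.P K).L : ℕ) : ℝ) * (fun l : ℕ => 2 * ((C_B + 1) * α * (F.L : ℝ) ^ (2 * l) * ((F.L : ℝ)⁻¹) ^ (2 * (K - J)))) i) + (((((F.P K).d - 1 : ℕ) : ℝ) * ((2 * (F.P K).L : ℕ) : ℝ) * (fun l : ℕ => 2 * ((C_B + 1) * α * (F.L : ℝ) ^ (2 * l) * ((F.L : ℝ)⁻¹) ^ (2 * (K - J)))) i) + ((((F.P K).L ^ (k - i) : ℕ) : ℝ) * (2 * (∑ i' ∈ Finset.range i, ((F.P K).L : ℝ) ^ (i - 1 - i') * (2 * (fun l : ℕ => if l < K - J then (((((F.P K).d + 2) * (F.P K).L : ℕ) : ℝ) ^ 2 / 4) * ((C_B + 1) * α * (F.L : ℝ) ^ (2 * l) * ((F.L : ℝ)⁻¹) ^ (2 * (K - J))) else 0) i')) + (fun l : ℕ => 2 * ((C_B + 1) * α * (F.L : ℝ) ^ (2 * l) * ((F.L : ℝ)⁻¹)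 ^ (2 * (K - J)))) i))))) ≤ ρr) := by
  have hL2 : (2 : ℝ) ≤ (F.L : ℝ) := by exact_mod_cast F.hL.2
  have hL1 : (1 : ℝ) ≤ (F.L : ℝ) := one_le_two.trans hL2
  have hL1' : (1 : ℝ) < ((F.P K).L : ℝ) := by show (1 : ℝ) < (F.L : ℝ); exact one_lt_two.trans_le hL2
  have hCB1 : (0 : ℝ) ≤ C_B + 1 := by linarith
  have hKA0 : (0 : ℝ) ≤ (((((F.P K).d + 2) * (F.P K).L : ℕ) : ℝ) ^ 2 / 4) := by positivity
  have hq : (0 : ℝ) ≤ ((F.L : ℝ) ^ (2 * (K - J)))⁻¹ := by positivity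
  have hCα : (0 : ℝ) ≤ ((((((F.P K).d + 2) * (F.P K).L : ℕ) : ℝ) ^ 2 / 4) * ((C_B + 1) * α)) := by positivity
  have hCδ : (0 : ℝ) ≤ (2 * ((C_B + 1) * α)) := by positivity
  have h3 : (0 : ℝ) ≤ ((F.P K).L : ℝ) ^ 2 - ((F.P K).L : ℝ) := by
    rw [sq]; exact sub_nonneg.2 (le_mul_of_one_le_left (zero_le_one.trans hL1'.le) hL1'.le)
  have hCε : (0 : ℝ) ≤ (2 * ((((((F.P K).d + 2) * (F.P K).L : ℕ) : ℝ) ^ 2 / 4) * ((C_B + 1) * α)) / (((F.P K).L : ℝ) ^ 2 - ((F.P K).L : ℝ))) := div_nonneg (by positivity) h3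
  have hθ0 : ∀ l : ℕ, 0 ≤ ((C_B + 1) * α * (F.L : ℝ) ^ (2 * l) * ((F.L : ℝ)⁻¹) ^ (2 * (K - J))) := fun l => bkgClass_nonneg F (C_B + 1) α hCB1 hα.le l
  have hα0' : ∀ l, 0 ≤ (fun l : ℕ => if l < K - J then (((((F.P K).d + 2) * (F.P K).L : ℕ) : ℝ) ^ 2 / 4) * ((C_B + 1) * α * (F.L : ℝ) ^ (2 * l) * ((F.L : ℝ)⁻¹) ^ (2 * (K - J))) else 0) l := by
    intro l; dsimp only; split_ifs
    · exact mul_nonneg hKA0 (hθ0 l)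
    · exact le_rfl
  have hθ1 : ∀ i, i < K - J → ((F.P K).L : ℝ) ^ (2 * i) * ((F.L : ℝ) ^ (2 * (K - J)))⁻¹ ≤ 1 := by
    intro i hi
    show (F.L : ℝ) ^ (2 * i) * ((F.L : ℝ) ^ (2 * (K - J)))⁻¹ ≤ 1
    rw [← div_eq_mul_inv, div_le_one (pow_pos (by linarith) _)]
    exact pow_le_pow_right₀ hL1 (by omega)
  have hαp : ∀ j, j < K - J → (fun l : ℕ => if l < K - J then (((((F.P K).d + 2) * (F.P K).L : ℕ) : ℝ) ^ 2 / 4) * ((C_B + 1) * α * (F.L : ℝ) ^ (2 * l) * ((F.L : ℝ)⁻¹) ^ (2 * (K - J))) else 0) j ≤ ((((((F.P K).d + 2) * (F.P K).L : ℕ) : ℝ) ^ 2 / 4) * ((C_B + 1) * α)) * ((F.P K).L : ℝ) ^ (2 * j) * ((F.L : ℝ) ^ (2 * (K - J)))⁻¹ := by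
    intro j hj
    dsimp only; rw [if_pos hj]
    show (((((F.P K).d + 2) * (F.P K).L : ℕ) : ℝ) ^ 2 / 4) * ((C_B + 1) * α * (F.L : ℝ) ^ (2 * j) * ((F.L : ℝ)⁻¹) ^ (2 * (K - J))) ≤ ((((((F.P K).d + 2) * (F.P K).L : ℕ) : ℝ) ^ 2 / 4) * ((C_B + 1) * α)) * (F.L : ℝ) ^ (2 * j) * ((F.L : ℝ) ^ (2 * (K - J)))⁻¹
    rw [inv_pow]; exact le_of_eq (by ring)
  have hδp : ∀ j : ℕ, 0 ≤ (fun l : ℕ => 2 * ((C_B + 1) * α * (F.L : ℝ) ^ (2 * l) * ((F.L : ℝ)⁻¹) ^ (2 * (K - J)))) j ∧ (fun l : ℕ => 2 * ((C_B + 1) * α * (F.L : ℝ) ^ (2 * l) * ((F.L : ℝ)⁻¹) ^ (2 * (K - J)))) j ≤ (2 * ((C_B + 1) * α)) * ((F.P K).L : ℝ) ^ (2 * j) * ((F.L : ℝ) ^ (2 * (K - J)))⁻¹ := by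
    intro j
    refine ⟨mul_nonneg zero_le_two (hθ0 j), ?_⟩
    show 2 * ((C_B + 1) * α * (F.L : ℝ) ^ (2 * j) * ((F.L : ℝ)⁻¹) ^ (2 * (K - J))) ≤ (2 * ((C_B + 1) * α)) * (F.L : ℝ) ^ (2 * j) * ((F.L : ℝ) ^ (2 * (K - J)))⁻¹
    rw [inv_pow]; exact le_of_eq (by ring)
  -- `ε` := the least solution of the line recursion (✓p841184)
  obtain ⟨hε0, hεnn, hε, hεp⟩ := epsLetters_of_profile (L := ((F.P K).L : ℝ)) (q := ((F.L : ℝ) ^ (2 * (K - J)))⁻¹) (Cα := ((((((F.P K).d + 2) * (F.P K).L : ℕ) : ℝ) ^ 2 / 4) * ((C_B + 1) * α))) hL1' hq hCα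
    (α := (fun l : ℕ => if l < K - J then (((((F.P K).d + 2) * (F.P K).L : ℕ) : ℝ) ^ 2 / 4) * ((C_B + 1) * α * (F.L : ℝ) ^ (2 * l) * ((F.L : ℝ)⁻¹) ^ (2 * (K - J))) else 0)) hα0' (K - J) hαp
  have hεp' : ∀ i, i < K - J → ∑ i' ∈ Finset.range i, ((F.P K).L : ℝ) ^ (i - 1 - i') * (2 * (fun l : ℕ => if l < K - J then (((((F.P K).d + 2) * (F.P K).L : ℕ) : ℝ) ^ 2 / 4) * ((C_B + 1) * α * (F.L : ℝ) ^ (2 * l) * ((F.L : ℝ)⁻¹) ^ (2 * (K - J))) else 0) i') ≤ (2 * ((((((F.P K).d + 2) * (F.P K).L : ℕ) : ℝ) ^ 2 / 4) * ((C_B + 1) * α)) / (((F.P K).L : ℝ) ^ 2 - ((F.P K).L : ℝ))) * ((F.P K).L : ℝ) ^ (2 * i) * ((F.L : ℝ) ^ (2 * (K - J)))⁻¹ :=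
    fun i hi => (hεp i hi.le).trans (le_of_eq (mul_assoc _ _ _).symm)
  refine ⟨hε0, hεnn, fun i _ => hε i, hεp', ?_⟩
  -- the window family from ONE K-free window (✓p841192)
  intro k hk i hi
  have hsmall : 100 * (((((F.P K).d + 2) * (F.P K).L : ℕ) : ℝ) * ((2 * ((((F.P K).d - 1 : ℕ) : ℝ) * ((2 * (F.P K).L : ℕ) : ℝ)) * (2 * ((C_B + 1) * α)) + (2 * (2 * ((((((F.P K).d + 2) * (F.P K).L : ℕ) : ℝ) ^ 2 / 4) * ((C_B + 1) * α)) / (((F.P K).L : ℝ) ^ 2 - ((F.P K).L : ℝ))) + (2 * ((C_B + 1) * α)))) * (((F.P K).L : ℝ) ^ (2 * k) * ((F.L : ℝ) ^ (2 * (K - J)))⁻¹))) ≤ ρr := by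
    refine le_trans ?_ hwinK
    have hS : 0 ≤ ((((F.P K).d + 2) * (F.P K).L : ℕ) : ℝ) * (2 * ((((F.P K).d - 1 : ℕ) : ℝ) * ((2 * (F.P K).L : ℕ) : ℝ)) * (2 * ((C_B + 1) * α)) + (2 * (2 * ((((((F.P K).d + 2) * (F.P K).L : ℕ) : ℝ) ^ 2 / 4) * ((C_B + 1) * α)) / (((F.P K).L : ℝ) ^ 2 - ((F.P K).L : ℝ))) + (2 * ((C_B + 1) * α)))) := by positivity
    have h := mul_le_of_le_one_right hS (hθ1 k hk)
    rw [mul_assoc] at h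
    exact mul_le_mul_of_nonneg_left h (by norm_num)
  rw [Nat.cast_pow]
  exact windows_of_profiles (L := ((F.P K).L : ℝ)) hL1'.le hq (Nat.cast_nonneg _) (by positivity) hCδ hCε k (fun l : ℕ => 2 * ((C_B + 1) * α * (F.L : ℝ) ^ (2 * l) * ((F.L : ℝ)⁻¹) ^ (2 * (K - J)))) (fun k : ℕ => ∑ i' ∈ Finset.range k, ((F.P K).L : ℝ) ^ (k - 1 - i') * (2 * (fun l : ℕ => if l < K - J then (((((F.P K).d + 2) * (F.P K).L : ℕ) : ℝ) ^ 2 / 4) * ((C_B + 1) * α * (F.L : ℝ) ^ (2 * l) * ((F.L : ℝ)⁻¹) ^ (2 * (K - J))) else 0) i'))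
    (fun j _ => hδp j) (fun j hj => ⟨hεnn j, hεp' j (by omega)⟩) hsmall i hi

/-- ★★★ **THE c₁ LETTER OVER (BKG) + (REG)@rep + C-M LETTERS ONLY** — ✓`c1Budget_physical` ∘ ✓`epsWin_of_bkg`; see the module header.
[cite: Balaban1985Averaging, Prop. 3 (123), Prop. 4 (128)-(135) pp.37-38; Balaban1985RegularSpaces, Thm 2 (1.36) p.82; Balaban1987RG1, (0.11), (0.18) pp.253-255] -/
theorem c1Budget_regRep {J K : ℕ} (hJK : J ≤ K) (Cst : ℝ) (hCst : 0 ≤ Cst)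
    (U₀ : GaugeField (F.P K) 0 (Matrix.specialUnitaryGroup (Fin 2) ℂ)) (ζ : PBond (F.P K) 0 → EuclideanSpace ℝ (Fin 3))
    (X : (i : ℕ) → PBond (F.P K) i → (specialUnitaryLogChart (Fin 2)).lie)
    (hXdef : X = fun (i : ℕ) (b : PBond (F.P K) i) =>
      (⟨su2Coord (rev (logVec (su2Quat (Averaging.iter (fun k => BlockAveraging.blockAvg (P := F.P K) (j := k) ℰp) i (fun ℓ => expPoint (ζ ℓ) * U₀ ℓ : GaugeField (F.P K) 0 (Matrix.specialUnitaryGroup (Fin 2) ℂ)) b * (Averaging.iter (fun k => BlockAveraging.blockAvg (P := F.P K) (j := k) ℰp) i U₀ b)⁻¹)))), su2Coord_rev_mem_lie _⟩ : (specialUnitaryLogChart (Fin 2)).lie))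
    (Mg : ℕ → ℝ) (hMg : ∀ t, t ≤ K - J → ∀ b : PBond (F.P K) t,
      ‖logVec (su2Quat (Averaging.iter (fun k => BlockAveraging.blockAvg (P := F.P K) (j := k) ℰp) t (fun ℓ => expPoint (ζ ℓ) * U₀ ℓ : GaugeField (F.P K) 0 (Matrix.specialUnitaryGroup (Fin 2) ℂ)) b * (Averaging.iter (fun k => BlockAveraging.blockAvg (P := F.P K) (j := k) ℰp) t U₀ b)⁻¹))‖ ≤ Mg t)
    (hMg4 : ∀ t, t ≤ K - J → Mg t ≤ 1 / 4)
    (C_B α : ℝ) (hCB : 0 ≤ C_B) (hα : 0 < α)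
    (hBKG : ∀ t, t ≤ K - J → ∀ p : Plaq (F.P K) t,
      dist1 (GaugeField.plaqHol (Averaging.iter (fun k => BlockAveraging.blockAvg (P := F.P K) (j := k) ℰp) t U₀) p) ≤
        C_B * α * (F.L : ℝ) ^ (2 * t) * ((F.L : ℝ)⁻¹) ^ (2 * (K - J)))
    (h24 : ((((F.P K).d + 2) * (F.P K).L : ℕ) : ℝ) ^ 2 / 4 * ((C_B + 1) * α) ≤ 1 / 24)
    (hSU : ((((F.P K).d + 2) * (F.P K).L : ℕ) : ℝ) ^ 2 / 4 * ((C_B + 1) * α) < deltaSU (Fin 2))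
    {ρr : ℝ} (hρ0 : 0 < ρr) (hρr : ρr ≤ innerRadius (specialUnitaryLogChart (Fin 2)))
    {a₀ : ℝ} (ha0 : 0 < a₀) (ha : 100 * (((((F.P K).d + 2) * (F.P K).L : ℕ) : ℝ) * (Real.exp a₀ - 1)) ≤ ρr)
    (Mb : ℕ → ℝ) (hMb0 : ∀ i, i < K - J → 0 ≤ Mb i) (hMb : ∀ i, i < K - J → ∀ b : PBond (F.P K) i, ‖X i b‖ ≤ Mb i) (hMb16 : ∀ i, i < K - J → 16 * Mb i ≤ a₀)
    (r c₀ : ℕ → ℝ)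
    (hwinK : 100 * (((((F.P K).d + 2) * (F.P K).L : ℕ) : ℝ) * (2 * ((((F.P K).d - 1 : ℕ) : ℝ) * ((2 * (F.P K).L : ℕ) : ℝ)) * (2 * ((C_B + 1) * α)) + (2 * (2 * ((((((F.P K).d + 2) * (F.P K).L : ℕ) : ℝ) ^ 2 / 4) * ((C_B + 1) * α)) / (((F.P K).L : ℝ) ^ 2 - ((F.P K).L : ℝ))) + (2 * ((C_B + 1) * α))))) ≤ ρr)
    (hc₀nn : ∀ k, 0 ≤ (F.L : ℝ) ^ k * c₀ k)
    (hc₀ : ∀ k, k < K - J → ∀ (μ : Fin (F.P K).d) (b : PBond (F.P K) 0), ‖(((fun b : PBond (F.P K) 0 => (⟨((rowProd U₀ b.src μ ((F.P K).L ^ k) : Matrix.specialUnitaryGroup (Fin 2) ℂ) : Matrix (Fin 2) (Fin 2) ℂ) * (((X 0) (b.translate (Site.scaleTo k ((0 : Site (F.P K) k).shift μ))) : (specialUnitaryLogChart (Fin 2)).lie) : Matrix (Fin 2) (Fin 2) ℂ) * star ((rowProd U₀ b.src μ ((F.P K).L ^ k) : Matrix.specialUnitaryGroup (Fin 2) ℂ)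 : Matrix (Fin 2) (Fin 2) ℂ), conj_mem_lie (rowProd U₀ b.src μ ((F.P K).L ^ k)) ((X 0) (b.translate (Site.scaleTo k ((0 : Site (F.P K) k).shift μ))))⟩ : (specialUnitaryLogChart (Fin 2)).lie)) b : (specialUnitaryLogChart (Fin 2)).lie) : Matrix (Fin 2) (Fin 2) ℂ) - (((X 0) b : (specialUnitaryLogChart (Fin 2)).lie) : Matrix (Fin 2) (Fin 2) ℂ)‖ ≤ (F.L : ℝ) ^ k * c₀ k)
    (hr0 : ∀ l, 0 ≤ r l)
    (hr : ∀ i, i < K - J → ∀ c' : PBond (F.P K) (i + 1),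
      ‖((X (i + 1) c' : (specialUnitaryLogChart (Fin 2)).lie) : Matrix (Fin 2) (Fin 2) ℂ) - (((fderiv ℝ (fun (B : PBond (F.P K) i → (specialUnitaryLogChart (Fin 2)).lie) (c' : PBond (F.P K) (i + 1)) => (isChartRep_specialUnitaryGroup (n := Fin 2)).logChart (avgFun (expMeanLogSU (n := Fin 2)) (fun c => (isChartRep_specialUnitaryGroup (n := Fin 2)).expChart (B c) * (Averaging.iter (fun i => blockAvg (P := F.P K) (j := i) (expMeanLogSU (n := Fin 2))) i U₀) c) c' * (avgFun (expMeanLogSU (n := Fin 2)) ((Averaging.iter (fun i => blockAvg (P := F.P K) (j := i) (expMeanLogSU (n := Fin 2))) i U₀)) c')⁻¹)) 0) (X i) c' : (specialUnitaryLogChart (Fin 2)).lie) : Matrix (Fin 2) (Fin 2) ℂ)‖ ≤ r (i + 1))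
    (Cr Cc mT : ℝ) (hCr : 0 ≤ Cr) (hCc : 0 ≤ Cc) (hmT : 0 ≤ mT)
    (hrp : ∀ i, i < K - J → r (i + 1) ≤ Cr * ((F.P K).L : ℝ) ^ (2 * i) * ((F.L : ℝ) ^ (2 * (K - J)))⁻¹)
    (hMT : ∀ k, k < K - J → ((1 + 4 * (((F.P K).d + 2 : ℕ) : ℝ)) * Real.exp ((((F.P K).d + 2 : ℕ) : ℝ) * (422 + 1616 * (((F.P K).d + 2 : ℕ) : ℝ)) * (((((((F.P K).d + 2) * (F.P K).L : ℕ) : ℝ) ^ 2 / 4) * ((C_B + 1) * α)) / (((F.P K).L : ℝ) ^ 2 - 1)))) * ((F.P K).L : ℝ) ^ k * ‖X 0‖ ≤ mT)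
    (hcc : ∀ k, k < K - J → ((1 + 4 * (((F.P K).d + 2 : ℕ) : ℝ)) * Real.exp ((((F.P K).d + 2 : ℕ) : ℝ) * (422 + 1616 * (((F.P K).d + 2 : ℕ) : ℝ)) * (((((((F.P K).d + 2) * (F.P K).L : ℕ) : ℝ) ^ 2 / 4) * ((C_B + 1) * α)) / (((F.P K).L : ℝ) ^ 2 - 1)))) * ((F.P K).L : ℝ) ^ k * ((F.L : ℝ) ^ k * c₀ k) ≤ Cc * (((F.P K).L : ℝ) ^ (2 * k) * ((F.L : ℝ) ^ (2 * (K - J)))⁻¹))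
    (hρα : 4 * ((((((F.P K).d + 2) * (F.P K).L : ℕ) : ℝ) ^ 2 / 4) * (2 * ((C_B + 1) * α))) ≤ ρr)
    (hρδ : 100 * (((((F.P K).d + 2) * (F.P K).L : ℕ) : ℝ) * ((((F.P K).d - 1 : ℕ) : ℝ) * ((3 * (F.P K).L : ℕ) : ℝ) * (2 * ((C_B + 1) * α)))) ≤ ρr)
    (m : ℝ)
    (hMbsq : ∀ i, i < K - J → Mb i ^ 2 ≤ m ^ 2 * ((F.L : ℝ) ^ (2 * i) / (F.L : ℝ) ^ (2 * (K - J))))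
    (hMbm : ∀ i, i < K - J → Mb i ≤ m)
    (c : ℝ) (hc0 : 0 ≤ c) (hc4 : 4 * c ≤ 1)
    (hζc : ∀ ℓ : PBond (F.P K) 0, ‖ζ ℓ‖ ≤ c * ((F.L : ℝ)⁻¹) ^ (K - J))
    (Mbar : ℝ) (hM0 : 0 ≤ Mbar) (hM1 : 4 * Mbar ≤ 1)
    (hM : ∀ s, s < K - J → ∀ b : PBond (F.P K) s, ‖logVec (su2Quat (Averaging.iter (fun k => BlockAveraging.blockAvg (P := F.P K) (j := k) ℰp) s (fun ℓ => expPoint (ζ ℓ) * U₀ ℓ : GaugeField (F.P K) 0 (Matrix.specialUnitaryGroup (Fin 2) ℂ)) b * (Averaging.iter (fun k => BlockAveraging.blockAvg (P := F.P K) (j := k) ℰp) s U₀ b)⁻¹))‖ ≤ Mbar) :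
    ∑ t ∈ Finset.range (K - J), (F.L : ℝ) ^ t * (fun t => Cst * ∑ B : PBond (F.P J) 0,
      ‖(fun p : Plaq (F.P K) (K - J - 1 - t) =>
        if ∃ z₀ : Site (F.P K) 0, (blockIter (K - J) z₀ = (bondShift (F.sitesPerDir_eq (m := F.m) (K := J) (j := 0) (m' := F.m) (K' := K) (j' := K - J) (by omega)) B).src ∨
            blockIter (K - J) z₀ = (bondShift (F.sitesPerDir_eq (m := F.m) (K := J) (j := 0) (m' := F.m) (K' := K) (j' := K - J) (by omega)) B).tgt) ∧
            ∀ κ, (rel (blockIter (K - J - 1 - t) z₀) p.src κ).natAbs ≤ (2 * F.L + 1)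
        then dist1 ((GaugeField.plaqHol (Averaging.iter (fun k => BlockAveraging.blockAvg (P := F.P K) (j := k) ℰp) (K - J - 1 - t) U₀) p)⁻¹ *
          GaugeField.plaqHol (Averaging.iter (fun k => BlockAveraging.blockAvg (P := F.P K) (j := k) ℰp) (K - J - 1 - t)
            (fun ℓ => expPoint (ζ ℓ) * U₀ ℓ : GaugeField (F.P K) 0 (Matrix.specialUnitaryGroup (Fin 2) ℂ))) p)
        else 0)‖ ^ 2) t ≤
      2 * ((2 * Cst * (((5 ^ (F.P K).d : ℕ) : ℝ) ^ 2 * (((2 * ((2 * F.L + 1) + 2) + 1) ^ (F.P K).d * 6 : ℕ) : ℝ) *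
              (2 * ((((F.P K).L ^ (F.P K).d : ℕ) : ℝ) - 1) / ((((F.P K).L ^ (F.P K).d : ℕ) : ℝ) - 3)))) * (4 * (F.L : ℝ)⁻¹ * ((F.L : ℝ) ^ (K - J) * ∑ p : Plaq (F.P K) 0,
                  (1 - reTr ((GaugeField.plaqHol U₀ p)⁻¹ * GaugeField.plaqHol (fun ℓ => expPoint (ζ ℓ) * U₀ ℓ : GaugeField (F.P K) 0 (Matrix.specialUnitaryGroup (Fin 2) ℂ)) p))) + 7 *
      (12 * ((F.P K).d : ℝ) ^ 2 * (2 * ((F.P K).L : ℝ) ^ 2 * (3 * (F.P K).L + 2) + 2 * ((F.P K).L : ℝ) ^ 2 + (48 * (F.P K).L + 24 * ((((F.P K).d + 2) * (F.P K).L : ℕ) : ℝ) + 1616 * ((((F.P K).d + 2) * (F.P K).L : ℕ) : ℝ)) * (((((F.P K).d + 2) * (F.P K).L : ℕ) : ℝ) ^ 2 / 4) +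
        2 * ((((F.P K).d + 2) * (F.P K).L : ℕ) : ℝ) * ((F.L : ℝ) ^ 2)) ^ 2 * (2 * ((C_B + 1) * α)) ^ 2 *
        (∑ t ∈ Finset.range (K - J), (if ht : t < K - J then
          (F.L : ℝ) ^ t * ∑ B : PBond (F.P J) 0,
            ‖(fun ℓ' : PBond (F.P (J + (t + 1))) 0 =>
              if ∃ z : Site (F.P (J + (t + 1))) 0,
                (B14.Eq22Determines.blockIter (t + 1) z = (bondShift (F.sitesPerDir_eq (m := F.m) (K := J) (j := 0) (m' := F.m) (K' := J + (t + 1)) (j' := t + 1) (by omega)) B).src ∨ B14.Eq22Determines.blockIter (t + 1) z = (bondShift (F.sitesPerDir_eq (m := F.m) (K := J) (j := 0) (m' := F.m) (K' := J + (t + 1)) (j' := t + 1) (by omega)) B).tgt) ∧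
                ∀ ν, (B10Eq27TorusAxialLog.rel z ℓ'.src ν).natAbs ≤ 2
              then logVec (su2Quat (descendTo F ℰp (J + (t + 1)) K (by omega) (fun ℓ => expPoint (ζ ℓ) * U₀ ℓ : GaugeField (F.P K) 0 (Matrix.specialUnitaryGroup (Fin 2) ℂ)) ℓ' * (descendTo F ℰp (J + (t + 1)) K (by omega) U₀ ℓ')⁻¹)) else 0)‖ ^ 2
        else 0)) / (F.L : ℝ) +
      (192 * ((F.P K).d : ℝ) ^ 2 *
        (16 * (54 * (((((F.P K).d + 2) * (F.P K).L : ℕ) : ℝ) * (Real.exp a₀ - 1))) * (2 * ((((F.P K).d : ℕ) : ℝ) * ((3 * (F.P K).L : ℕ) : ℝ)) * (2 * (2 * ((((((F.P K).d + 2) * (F.P K).L : ℕ) : ℝ) ^ 2 / 4) * ((C_B + 1) * α)) / (((F.P K).L : ℝ) ^ 2 - ((F.P K).L : ℝ))) * mT + mT * (((1 + 4 * (((F.P K).d + 2 : ℕ) : ℝ)) * Real.exp ((((F.P K).d + 2 : ℕ) : ℝ) * (422 + 1616 * (((F.P K).d + 2 : ℕ) : ℝ)) * (((((((F.P K).d +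 2) * (F.P K).L : ℕ) : ℝ) ^ 2 / 4) * ((C_B + 1) * α)) / (((F.P K).L : ℝ) ^ 2 - 1)))) / ((F.P K).L : ℝ)) * ((2 * 67 * ((((F.P K).d + 2) * (F.P K).L : ℕ) : ℝ) / a₀) * (2 * ((((F.P K).d - 1 : ℕ) : ℝ) * ((2 * (F.P K).L : ℕ) : ℝ)) * (2 * ((C_B + 1) * α)) / (((F.P K).L : ℝ) ^ 2 - 1) + (2 * (2 * ((((((F.P K).d + 2) * (F.P K).L : ℕ) : ℝ) ^ 2 / 4) * ((C_B + 1) * α)) / (((F.P K).L : ℝ) ^ 2 - ((F.P K).L : ℝ))) + (2 * ((C_B + 1) * α))) / (((F.P K).L : ℝ) - 1))) + Cc + 2 * (((1 + 4 * (((F.P K).d + 2 : ℕ) : ℝ)) * Real.exp ((((F.P K).d + 2 : ℕ) : ℝ) * (422 + 1616 * (((F.P K).d + 2 : ℕ) : ℝ)) * (((((((F.P K).d + 2) * (F.P K).L : ℕ) : ℝ) ^ 2 / 4) * ((C_B + 1) * α)) / (((F.P K).L : ℝ) ^ 2 - 1)))) * Cr / (((F.P K).L : ℝ) ^ 2 -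 ((F.P K).L : ℝ))))) / (15 * a₀ / 16) ^ 2 + 32 * (54 * (((((F.P K).d + 2) * (F.P K).L : ℕ) : ℝ) * (Real.exp a₀ - 1))) * (2 * ((((F.P K).d : ℕ) : ℝ) * ((3 * (F.P K).L : ℕ) : ℝ)) * (2 * (2 * ((((((F.P K).d + 2) * (F.P K).L : ℕ) : ℝ) ^ 2 / 4) * ((C_B + 1) * α)) / (((F.P K).L : ℝ) ^ 2 - ((F.P K).L : ℝ))) * mT + mT * (((1 + 4 * (((F.P K).d + 2 : ℕ) : ℝ)) * Real.exp ((((F.P K).d + 2 : ℕ) : ℝ) * (422 + 1616 * (((F.P K).d + 2 : ℕ) : ℝ)) * (((((((F.P K).d + 2) * (F.P K).L : ℕ) : ℝ) ^ 2 / 4) * ((C_B + 1) * α)) / (((F.P K).L : ℝ) ^ 2 - 1)))) / ((F.P K).L : ℝ)) * ((2 * 67 * ((((F.P K).d + 2) * (F.P K).L : ℕ) : ℝ) / a₀) * (2 * ((((F.P K).d - 1 : ℕ) : ℝ) * ((2 * (F.P K).L : ℕ) : ℝ)) * (2 * ((C_B + 1) * α)) / (((F.P K).L : ℝ) ^ 2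 - 1) + (2 * (2 * ((((((F.P K).d + 2) * (F.P K).L : ℕ) : ℝ) ^ 2 / 4) * ((C_B + 1) * α)) / (((F.P K).L : ℝ) ^ 2 - ((F.P K).L : ℝ))) + (2 * ((C_B + 1) * α))) / (((F.P K).L : ℝ) - 1))) + Cc + 2 * (((1 + 4 * (((F.P K).d + 2 : ℕ) : ℝ)) * Real.exp ((((F.P K).d + 2 : ℕ) : ℝ) * (422 + 1616 * (((F.P K).d + 2 : ℕ) : ℝ)) * (((((((F.P K).d + 2) * (F.P K).L : ℕ) : ℝ) ^ 2 / 4) * ((C_B + 1) * α)) / (((F.P K).L : ℝ) ^ 2 - 1)))) * Cr / (((F.P K).L : ℝ) ^ 2 - ((F.P K).L : ℝ))))) / a₀ ^ 2 +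
          ((((F.P K).d + 2) * (F.P K).L : ℕ) : ℝ) ^ 3 * m ^ 2 + 8 * (67 * (((((F.P K).d + 2) * (F.P K).L : ℕ) : ℝ) * ((((F.P K).d - 1 : ℕ) : ℝ) * ((3 * (F.P K).L : ℕ) : ℝ) * (2 * ((C_B + 1) * α))))) * m / a₀ ^ 2) ^ 2 *
        (∑ t ∈ Finset.range (K - J), (if ht : t < K - J then
          (F.L : ℝ) ^ t * ∑ B : PBond (F.P J) 0,
            ‖(fun ℓ' : PBond (F.P (J + (t + 1))) 0 =>
              if ∃ z : Site (F.P (J + (t + 1))) 0,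
                (B14.Eq22Determines.blockIter (t + 1) z = (bondShift (F.sitesPerDir_eq (m := F.m) (K := J) (j := 0) (m' := F.m) (K' := J + (t + 1)) (j' := t + 1) (by omega)) B).src ∨ B14.Eq22Determines.blockIter (t + 1) z = (bondShift (F.sitesPerDir_eq (m := F.m) (K := J) (j := 0) (m' := F.m) (K' := J + (t + 1)) (j' := t + 1) (by omega)) B).tgt) ∧
                ∀ ν, (B10Eq27TorusAxialLog.rel z ℓ'.src ν).natAbs ≤ 2
              then logVec (su2Quat (descendTo F ℰp (J + (t + 1)) K (by omega) (fun ℓ => expPoint (ζ ℓ) * U₀ ℓ : GaugeField (F.P K) 0 (Matrix.specialUnitaryGroup (Fin 2) ℂ)) ℓ' * (descendTo F ℰp (J + (t + 1)) K (by omega) U₀ ℓ')⁻¹)) else 0)‖ ^ 2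
        else 0)) / (F.L : ℝ)) +
      3 * ((768 * c ^ 2 * (F.L : ℝ)) *
        (((F.L : ℝ)⁻¹) ^ (K - J) * ∑ ℓ : PBond (F.P K) 0, ‖ζ ℓ‖ ^ 2 +
          (F.L : ℝ) ^ (K - J) * ∑ p : Plaq (F.P K) 0,
            (1 - reTr ((GaugeField.plaqHol U₀ p)⁻¹ * GaugeField.plaqHol (fun ℓ => expPoint (ζ ℓ) * U₀ ℓ : GaugeField (F.P K) 0 (Matrix.specialUnitaryGroup (Fin 2) ℂ)) p))))))) +
      2 * ((256 * Cst * Mbar ^ 2 * ((2 * (F.P J).d * (2 * 3 + 1) ^ (F.P J).d : ℕ) : ℝ)) * (∑ t ∈ Finset.range (K - J), (if ht : t < K - J then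
          (F.L : ℝ) ^ t * ∑ B : PBond (F.P J) 0,
            ‖(fun ℓ' : PBond (F.P (J + (t + 1))) 0 =>
              if ∃ z : Site (F.P (J + (t + 1))) 0,
                (B14.Eq22Determines.blockIter (t + 1) z = (bondShift (F.sitesPerDir_eq (m := F.m) (K := J) (j := 0) (m' := F.m) (K' := J + (t + 1)) (j' := t + 1) (by omega)) B).src ∨ B14.Eq22Determines.blockIter (t + 1) z = (bondShift (F.sitesPerDir_eq (m := F.m) (K := J) (j := 0) (m' := F.m) (K' := J + (t + 1)) (j' := t + 1) (by omega)) B).tgt) ∧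
                ∀ ν, (B10Eq27TorusAxialLog.rel z ℓ'.src ν).natAbs ≤ 2
              then logVec (su2Quat (descendTo F ℰp (J + (t + 1)) K (by omega) (fun ℓ => expPoint (ζ ℓ) * U₀ ℓ : GaugeField (F.P K) 0 (Matrix.specialUnitaryGroup (Fin 2) ℂ)) ℓ' * (descendTo F ℰp (J + (t + 1)) K (by omega) U₀ ℓ')⁻¹)) else 0)‖ ^ 2
        else 0))) := by
  obtain ⟨hε0, hεnn, hε, hεp, hwin⟩ := epsWin_of_bkg F (J := J) (K := K) C_B α hCB hα hwinK
  have hL2 : (2 : ℝ) ≤ (F.L : ℝ) := by exact_mod_cast F.hL.2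
  have hL1' : (1 : ℝ) ≤ ((F.P K).L : ℝ) := by show (1 : ℝ) ≤ (F.L : ℝ); exact one_le_two.trans hL2
  have h3 : (0 : ℝ) ≤ ((F.P K).L : ℝ) ^ 2 - ((F.P K).L : ℝ) := by
    rw [sq]; exact sub_nonneg.2 (le_mul_of_one_le_left (zero_le_one.trans hL1') hL1')
  have hCε : (0 : ℝ) ≤ (2 * ((((((F.P K).d + 2) * (F.P K).L : ℕ) : ℝ) ^ 2 / 4) * ((C_B + 1) * α)) / (((F.P K).L : ℝ) ^ 2 - ((F.P K).L : ℝ))) := div_nonneg (by positivity) h3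
  exact c1Budget_physical F hJK Cst hCst U₀ ζ X hXdef Mg hMg hMg4 C_B α hCB hα hBKG h24 hSU hρ0 hρr ha0 ha Mb hMb0 hMb hMb16
    (fun k : ℕ => ∑ i' ∈ Finset.range k, ((F.P K).L : ℝ) ^ (k - 1 - i') * (2 * (fun l : ℕ => if l < K - J then (((((F.P K).d + 2) * (F.P K).L : ℕ) : ℝ) ^ 2 / 4) * ((C_B + 1) * α * (F.L : ℝ) ^ (2 * l) * ((F.L : ℝ)⁻¹) ^ (2 * (K - J))) else 0) i')) r c₀ hε0 hεnn hε hwin hc₀nn hc₀ hr0 hr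
    (2 * ((((((F.P K).d + 2) * (F.P K).L : ℕ) : ℝ) ^ 2 / 4) * ((C_B + 1) * α)) / (((F.P K).L : ℝ) ^ 2 - ((F.P K).L : ℝ))) Cr Cc mT hCε hCr hCc hmT hεp hrp hMT hcc hρα hρδ m hMbsq hMbm c hc0 hc4 hζc Mbar hM0 hM1 hM

end Summit.QuantumFields.YangMills.Theorems.FluctuationComparisonRegPrIntLS2BetaCurlBudgetRegRep

end
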